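import Summits.BirchSwinnertonDyer.BirchSwinnertonDyer.Theorems.ClassRecordThreeCornerAtThreeShimuraFamilyLevelData
import Summits.BirchSwinnertonDyer.BirchSwinnertonDyer.Theorems.ClassRecordThreeEulerHalvesAtThreeShimuraStringentOfOrbitReceptacle
import Summits.BirchSwinnertonDyer.BirchSwinnertonDyer.Theorems.ClassRecordThreeEulerHalvesAtThreeShimuraE0ReceptacleOfLabelB6
import Summits.BirchSwinnertonDyer.BirchSwinnertonDyer.Theorems.ErratumRoadFiveShimuraKolyvaginOrderBoundInertCarrierGlue
import Summits.BirchSwinnertonDyer.Rank1Residual.X11b.KolyvaginPointInertia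
import HarnessLib

/-!
# Jetchev 2008 Prop. 4.9 — the STRINGENT condition `loc_v c_M(m) ∈ δ_v(E₀(K_v))` at a split bad place — for the classes of a family of
# GENERALISED Kolyvagin data, from the labels (B4) and the (B6)-receptacle: tam3-p1 g12's `…StringentOfOrbitReceptacle` (p594055, «for ANY
# presentation») INSTANTIATED on the family level-data package (cell `bsd-stepL`, seat `bsd-stepL-corner3-p2` g8 = WIDTH-LEVER lane B;
# `--supports stmt-BirchSwinnertonDyer-21420 --as helper`)

WHY (PORT MAP (P2) §2 (iv) `h49str`; tam3-p1 g12 HANDOFF OWED (i) «instantiate p594055 at lane B's level data when the `LevelSupplyAtThree`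
assembly fixes its shapes»). The walk's `h49` (Jetchev Prop. 4.9: the class at the deeper conductor lies in the STRINGENT structure at the
carrier place) is p594055 for any presented labelled family. THIS FILE: `localization_kolyvaginClass_familyData_mem_stringentFamily` — for a family
`d : (m ∣ n) → JET.KolyvaginFamilyData W K ι m` over a square-free top level on Kolyvagin primes of Gross depth `M ≥ 1`, a level `m ∣ n`, a bad
place `v ∤ m` of `K` over a prime `q` SPLIT in `K` (`((q).primesOver 𝓞_K).ncard = 2`, the frame clause at `q ∉ S`; minimality of `E∕K_v` by
`natCast_mem_and_isMinimal_of_split`), the weak (B4) label in datum form, the receptacle at `v` for the orbits of `y(m)` and of the `y(m∕ℓ)↑`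
(= g5's `receptacle_of_labelB6` output at `q`, i.e. (B6)), `n′` prime to `p^M` and admissibility:
`loc_v ((d m hm).kolyvaginClass hp M) ∈ stringentFamily W K _ (Sum.inr v)`. Proof: p594055 on the level data of `exists_levelData_familyData`
(p599103) with `z_ℓ := y(m∕ℓ)↑`, `a_ℓ := a_ℓ(E)`; `hgen` from the datum's generators, `hP` from (B4) (`map_kolyvaginPoint_mem_invPoints`), `hI`
from `KolyvaginH44.smul_kolyvaginPoint_eq_of_mem_localInertia`, (3.3) `p^M ∣ a_ℓ` from `pow_dvd_frobeniusTrace_of_kolyvaginPrime`; the class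
identified with the datum's by the H37-bridge conjunct. HONEST FRAMING: one theorem (no definition, no named fact, no `sorry`); CONDITIONAL on the
displayed labels; nothing about any Heegner ∕ CM point is constructed; no stub closes; BSD is not proved by any of this; T7.
Credit: tam3-p1 g12 (p594055, receptacle), bsd-jet (stringent END), x11b3, shim-p1.
References: [cite: Jetchev2008, Prop. 4.9 (pp. 819–820), Def. 4.8] [cite: GrossLMS1991, §3 Prop. 3.7 (1), (3.3), §4 (4.1), §6 Prop. 6.2 (1)]
[cite: MilneADT2006, Ch. I Prop. 3.8]. presearch: not applicable (instantiation of a tree theorem); `lean search 'familyData_mem_stringentFamily'` → none.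
-/

set_option autoImplicit false
set_option linter.dupNamespace false

noncomputable section

open scoped Classical
open scoped AddSubgroup

namespace Summit.BirchSwinnertonDyer.BirchSwinnertonDyer.Theorems.ShimuraWalk

open WeierstrassCurve Field NumberField IsDedekindDomain Finset
  Literature.NumberTheory.EllipticCurves Literature.NumberTheory.GaloisRepresentations
  Literature.NumberTheory.EllipticCurves.KolyvaginCocycle
  Literature.NumberTheory.EllipticCurves.KolyvaginEuler
  Literature.NumberTheory.EllipticCurves.RingClassField
  Literature.NumberTheory.EllipticCurves.ModularForms
  Summit.BirchSwinnertonDyer.Rank1Residual.X11b Summit.BirchSwinnertonDyer.Rank1Residual.X11b.Three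
  Summit.BirchSwinnertonDyer.Rank1Residual.JET
  Summit.BirchSwinnertonDyer.BirchSwinnertonDyer.Theorems

variable {K : Type} [Field K] [NumberField K] {W : WeierstrassCurve ℚ}

set_option maxHeartbeats 800000 in
/-- **Jetchev Prop. 4.9 for the classes of a family of generalised Kolyvagin data at a split bad place, from (B4) + the (B6)-receptacle**;
see the module docstring. [cite: Jetchev2008, Prop. 4.9] [cite: GrossLMS1991, Prop. 3.7 (1), (3.3), §4 (4.1)] -/
theorem localization_kolyvaginClass_familyData_mem_stringentFamily {N : ℕ} [NeZero N] [W.IsElliptic] [W.IsGloballyMinimal]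
    (hK : IsImaginaryQuadratic K) (ι : K →+* ℂ)
    {p M : ℕ} (hp : p.Prime) (hM : 1 ≤ M) (hn' : ((p ^ M : ℕ) : ℤ) ≠ 0) (Dt : ModularParametrizationData W N)
    {n : ℕ} (hn : Squarefree n)
    (hKol : ∀ q ∈ n.primeFactors, IsKolyvaginPrime N W K p q ∧ FrobEqFrobInfty W K (p ^ M) q)
    (d : (m : ℕ) → m ∣ n → KolyvaginFamilyData W K ι m)
    (hB4d : ∀ (m : ℕ) (hm : m ∣ n), ∀ (ℓ : ℕ) (hℓ : ℓ ∈ m.primeFactors)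
      (hle : ringClassField K ι (m / ℓ) ≤ ringClassField K ι m),
      ∑ i ∈ Finset.range (ℓ + 1), pointGalHom W (ringClassField K ι m) ((d m hm).σ ℓ ^ i) (d m hm).y =
        W.frobeniusTrace ℓ • WeierstrassCurve.Affine.Point.map (W' := W)
          ((RingClassField.inclusion ι hle).restrictScalars ℚ)
          (d (m / ℓ) ((Nat.div_dvd_of_dvd (Nat.dvd_of_mem_primeFactors hℓ)).trans hm)).y)
    (hA : ∀ (m : ℕ) (hm : m ∣ n),
      IsAdmissible (absoluteGaloisGroup K) (d m hm).pointsSubgroup ((p ^ M : ℕ) : ℤ))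
    {m : ℕ} (hm : m ∣ n)
    (q : ℕ) [Fact q.Prime] (hqN : q ∣ N) (hq2 : ((Ideal.span {(q : ℤ)}).primesOver (𝓞 K)).ncard = 2)
    (v : HeightOneSpectrum (𝓞 K)) (hqv : ((q : ℕ) : 𝓞 K) ∈ v.asIdeal) (hmv : (m : 𝓞 K) ∉ v.asIdeal)
    (hbad : ¬ (W.baseChange K).HasGoodReductionAt v)
    {n'' : ℤ} (hcop : IsCoprime ((p ^ M : ℕ) : ℤ) n'')
    (hrec : ∀ (γ : ringClassField K ι m ≃ₐ[ℚ] ringClassField K ι m),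
      n'' • pointsMap (W.baseChange K) (v.adicCompletion K)
          ((d m hm).toGeomPoints (pointGalHom W (ringClassField K ι m) γ (d m hm).y)) ∈
        E0Receptacle (W.baseChange K) v ∧
      ∀ (ℓ : ℕ) (hℓ : ℓ ∈ m.primeFactors)
        (hle : ringClassField K ι (m / ℓ) ≤ ringClassField K ι m),
        n'' • pointsMap (W.baseChange K) (v.adicCompletion K)
            ((d m hm).toGeomPoints (pointGalHom W (ringClassField K ι m) γ
              (WeierstrassCurve.Affine.Point.map (W' := W)
                ((RingClassField.inclusion ι hle).restrictScalars ℚ)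
                (d (m / ℓ) ((Nat.div_dvd_of_dvd (Nat.dvd_of_mem_primeFactors hℓ)).trans hm)).y))) ∈
          E0Receptacle (W.baseChange K) v) :
    galoisCohomology.localization ((W.baseChange K).torsionGaloisModule ((p ^ M : ℕ) : ℤ)) (Sum.inr v) 1
        ((d m hm).kolyvaginClass hp M) ∈
      stringentFamily W K hn' (Sum.inr v) := by
  haveI : Fact p.Prime := ⟨hp⟩
  have hn0 : n ≠ 0 := Squarefree.ne_zero hn
  have hm0 : m ≠ 0 := ne_zero_of_dvd_ne_zero hn0 hm
  have hinert : ∀ q ∈ n.primeFactors, (Ideal.span {(q : 𝓞 K)}).IsPrime :=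
    fun q hq ↦ (hKol q hq).1.2.2.2.2.1
  have hdiv : ∀ Q : geomPoints (W.baseChange K), ∃ R, ((p ^ M : ℕ) : ℤ) • R = Q :=
    (W.baseChange K).zsmul_geomPoints_surjective_of_charZero
      (by exact_mod_cast pow_ne_zero M hp.ne_zero)
  -- the structures and THE SEAM
  letI hcg : ∀ k, CommGroup (ringClassGal ι k) := fun k ↦
    { (inferInstance : Group (ringClassGal ι k)) with
      mul_comm := fun a b ↦ (KolyvaginH44.isMulCommutative_ringClassGal' hK ι k).is_comm.comm a b }
  letI act : ∀ k, DistribMulAction (ringClassGal ι k)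
      ((W.baseChange (ringClassField K ι k)).toAffine.Point) := fun k ↦
    DistribMulAction.compHom _ ((pointGalHom W (ringClassField K ι k)).comp (ringClassGal ι k).subtype)
  choose σ H hF f y π j e hord hj hπρ hfsec hHρ hdict hjunk using
    fun k ↦ exists_levelData_familyData (W := W) hK ι hn hinert d k
  letI hft : ∀ k, Fintype (ringClassGal ι k ⧸ H k) := hF
  have hsmul : ∀ (k) (g : ringClassGal ι k) (Q : (W.baseChange (ringClassField K ι k)).toAffine.Point),
      g • Q = pointGalHom W (ringClassField K ι k)
        (g : ringClassField K ι k ≃ₐ[ℚ] ringClassField K ι k) Q := fun _ _ _ ↦ rfl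
  set ρ : ∀ k, ringClassGal ι k →* (ringClassField K ι k ≃ₐ[ℚ] ringClassField K ι k) :=
    fun k ↦ (ringClassGal ι k).subtype with hρdef
  have hρ : ∀ k, Function.Injective (ρ k) := fun k ↦ (ringClassGal ι k).subtype_injective
  have hj' : ∀ (k) (g : absoluteGaloisGroup K)
      (a : (W.baseChange (ringClassField K ι k)).toAffine.Point),
      j k (π k g • a) = g • j k a := fun k g a ↦ by rw [hsmul]; exact hj k g a
  have hπρ' : ∀ (k) (τ : absoluteGaloisGroup K) (x : ringClassField K ι k),
      τ • e k x = e k (ρ k (π k τ) x) := fun k τ x ↦ hπρ k τ x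
  obtain ⟨hjm, hym, hσm, hfS, hem, hPm⟩ := hdict m hm
  have hle : ∀ {ℓ : ℕ}, ℓ ∈ m.primeFactors → ringClassField K ι (m / ℓ) ≤ ringClassField K ι m :=
    fun hℓ ↦ ringClassField_mono hK ι (Nat.div_dvd_of_dvd (Nat.dvd_of_mem_primeFactors hℓ)) hm0
  have hm' : ∀ {ℓ : ℕ}, ℓ ∈ m.primeFactors → m / ℓ ∣ n := fun hℓ ↦
    (Nat.div_dvd_of_dvd (Nat.dvd_of_mem_primeFactors hℓ)).trans hm
  -- the witnesses `z_ℓ := y(m/ℓ)↑`, `a_ℓ := a_ℓ(E)` of (B4)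
  let z : ℕ → (W.baseChange (ringClassField K ι m)).toAffine.Point := fun ℓ ↦
    if hℓ : ℓ ∈ m.primeFactors then WeierstrassCurve.Affine.Point.map (W' := W)
      ((RingClassField.inclusion ι (hle hℓ)).restrictScalars ℚ) (d (m / ℓ) (hm' hℓ)).y else 0
  have hz : ∀ (ℓ : ℕ) (hℓ : ℓ ∈ m.primeFactors), z ℓ = WeierstrassCurve.Affine.Point.map (W' := W)
      ((RingClassField.inclusion ι (hle hℓ)).restrictScalars ℚ) (d (m / ℓ) (hm' hℓ)).y :=
    fun ℓ hℓ ↦ dif_pos hℓ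
  have htrace : ∀ ℓ ∈ m.primeFactors,
      grAct ((W.baseChange (ringClassField K ι m)).toAffine.Point) (traceElt (σ m ℓ) ℓ) (y m) =
        W.frobeniusTrace ℓ • z ℓ := by
    intro ℓ hℓ
    rw [hz ℓ hℓ, grAct_traceElt, hym, ← hB4d m hm ℓ hℓ (hle hℓ)]
    refine Finset.sum_congr rfl fun i _ ↦ ?_
    rw [hsmul, Subgroup.coe_pow, hσm ℓ hℓ]
  have ha : ∀ ℓ ∈ m.primeFactors, ((p ^ M : ℕ) : ℤ) ∣ W.frobeniusTrace ℓ := fun ℓ hℓ ↦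
    pow_dvd_frobeniusTrace_of_kolyvaginPrime (K := K) Dt hp hM (hKol ℓ (Nat.primeFactors_mono hm hn0 hℓ)).1
      (hKol ℓ (Nat.primeFactors_mono hm hn0 hℓ)).2
  have htrA : ∀ ℓ ∈ m.primeFactors,
      grAct ((W.baseChange (ringClassField K ι m)).toAffine.Point) (traceElt (σ m ℓ) ℓ) (y m) ∈
        zsmulRange ((W.baseChange (ringClassField K ι m)).toAffine.Point) ((p ^ M : ℕ) : ℤ) :=
    fun ℓ hℓ ↦ grAct_traceElt_mem_of_eq_smul (htrace ℓ hℓ) (ha ℓ hℓ)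
  -- Euler hypotheses, admissibility, invariance, inertia at level `m`
  have hgen : H m ≤ Subgroup.closure (σ m '' (m.primeFactors : Set ℕ)) :=
    le_closure_of_map_zpowers hK ι (hn.squarefree_of_dvd hm) (σ m) (H m) (ρ m) (hρ m)
      (fun q hq ↦ by
        rw [MonoidHom.map_zpowers]
        change Subgroup.zpowers (σ m q : ringClassField K ι m ≃ₐ[ℚ] ringClassField K ι m) = _
        rw [hσm q hq]; exact (d m hm).zpowers_σ q hq)
      (hHρ m)
  have hdvd : ∀ ℓ ∈ m.primeFactors, ((p ^ M : ℕ) : ℤ) ∣ ((ℓ + 1 : ℕ) : ℤ) := by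
    intro ℓ hℓ
    obtain ⟨hℓK, hℓM⟩ := hKol ℓ (Nat.primeFactors_mono hm hn0 hℓ)
    exact (IsKolyvaginPrime.pow_dvd_add_one W hp hℓK hM hℓM).1
  have hA' : IsAdmissible (absoluteGaloisGroup K) (j m).range ((p ^ M : ℕ) : ℤ) := by
    rw [hjm]; exact hA m hm
  have hPt' : j m (kolyvaginPoint (σ m) m.primeFactors (f m) (y m)) ∈
      invPoints (absoluteGaloisGroup K) (j m).range ((p ^ M : ℕ) : ℤ) :=
    map_kolyvaginPoint_mem_invPoints (hfsec m) hgen (hord m) hdvd htrA (π m) (j m) (hj' m)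
  obtain ⟨𝔐, h𝔐⟩ := v.localPrimesAbove_nonempty
  have hI' : ∀ t ∈ 𝔐.inertia (absoluteGaloisGroup (v.adicCompletion K)),
      resGal (K := K) (v.adicCompletion K) t • j m (kolyvaginPoint (σ m) m.primeFactors (f m) (y m)) =
        j m (kolyvaginPoint (σ m) m.primeFactors (f m) (y m)) :=
    KolyvaginH44.smul_kolyvaginPoint_eq_of_mem_localInertia (W := W) hK ι σ
      (fun k ↦ k.primeFactors) H f y π j hj' e ρ hρ hπρ' m v hmv 𝔐 h𝔐
  -- the receptacle for the orbits of `y(m)` and of the `z_ℓ`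
  have hrec' : ∀ γ : ringClassGal ι m,
      n'' • pointsMap (W.baseChange K) (v.adicCompletion K) (j m (γ • y m)) ∈ E0Receptacle (W.baseChange K) v ∧
      ∀ ℓ ∈ m.primeFactors,
        n'' • pointsMap (W.baseChange K) (v.adicCompletion K) (j m (γ • z ℓ)) ∈ E0Receptacle (W.baseChange K) v := by
    intro γ
    refine ⟨?_, fun ℓ hℓ ↦ ?_⟩
    · rw [hsmul, hjm, hym]; exact (hrec γ).1
    · rw [hsmul, hjm, hz ℓ hℓ]; exact (hrec γ).2 ℓ hℓ (hle hℓ)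
  -- minimality of `E/K_v` at the split place
  obtain ⟨-, hmin⟩ := ShimuraKolyvaginOfImage.natCast_mem_and_isMinimal_of_split W hK q hq2 hqN v hqv
  haveI := hmin
  -- the abstract class IS the datum's class
  have hP : j m (kolyvaginPoint (σ m) m.primeFactors (f m) (y m)) =
      (d m hm).toGeomPoints (d m hm).derivedPoint := by rw [hjm, hPm]
  have hPt : (d m hm).toGeomPoints (d m hm).derivedPoint ∈
      invPoints (absoluteGaloisGroup K) (d m hm).pointsSubgroup ((p ^ M : ℕ) : ℤ) := by
    have h := hPt'
    rw [hP, hjm] at h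
    exact h
  have hc : (d m hm).kolyvaginClass hp M =
      kolyvaginClass (W.baseChange K) ((p ^ M : ℕ) : ℤ) hdiv hA'
        (j m (kolyvaginPoint (σ m) m.primeFactors (f m) (y m))) hPt' := by
    rw [KolyvaginFamilyData.kolyvaginClass_def, dif_pos ⟨hA m hm, hPt⟩]
    exact KolyvaginH44.kolyvaginClass_congr (by rw [hjm]; rfl) hP.symm
  rw [hc]
  exact ShimuraKolyvaginOfImage.localization_kolyvaginClass_mem_stringentFamily_of_orbitReceptacle hn' hdiv
    (hfsec m) hgen (hord m) hdvd (π m) (j m) (hj' m) hA' hPt' v hbad h𝔐 hI' z (fun ℓ ↦ W.frobeniusTrace ℓ)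
    htrace ha hcop hrec'

end Summit.BirchSwinnertonDyer.BirchSwinnertonDyer.Theorems.ShimuraWalk

end
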